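/-
Copyright (c) 2026. All rights reserved.
Released under Apache 2.0 license as described in the file LICENSE.
Authors: HodgeCM publication cell (pub-hodgecm), model-construction sub-cell, construction prover `mc-weil-2`.
-/
import Mathlib.Topology.Algebra.RestrictedProduct.Basic
import Mathlib.Algebra.BigOperators.Finprod
import Literature.GroupTheory.CocycleCentralExtension
import HarnessLib

/-!
# Restricted products of cocycle extensions: the adelic metaplectic-type group and adelic splittings

Topic `NumberTheory/Automorphic`; namespace `Literature.NumberTheory.Automorphic.RestrictedCocycle`.

LOCAL-TO-GLOBAL ALGEBRA for central extensions defined by cocycles (file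
`Literature/GroupTheory/CocycleCentralExtension.lean`).  Index set `ι` (the places `v`), groups `G_v` with
distinguished subgroups `K_v` (hyperspecial compact opens), a commutative coefficient group `A` (`ℂ^×`, `ℂ¹`,
`μ₈`), and LOCAL normalized central 2-cocycles `c_v : G_v × G_v → A` which are TRIVIAL ON `K_v × K_v` FOR ALMOST
ALL `v`.  We CONSTRUCT the ADELIC COCYCLE on Mathlib's restricted product `Πʳ v, [G_v, K_v]`,
`c_𝔸(x, y) = ∏_v c_v(x_v, y_v)` (a finite product), prove it is a normalized central 2-cocycle, hence obtain the
adelic twisted product `(Πʳ_v G_v) ×_{c_𝔸} A` with the local embeddings `G_v ×_{c_v} A → (Πʳ G) ×_{c_𝔸} A`;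
and for LOCAL SPLITTING FUNCTIONS `β_v : H_v → A` of `c_v` over `ι_v : H_v → G_v`, TRIVIAL ON `K′_v` FOR ALMOST
ALL `v`, we CONSTRUCT the adelic splitting function `β_𝔸(h) = ∏_v β_v(h_v)` and PROVE that it splits `c_𝔸` over
the restricted-product map `ι_𝔸 = ∏_v ι_v`, compatibly with the local embeddings; finally the RATIONAL-POINTS
CLAUSE: at a point `γ` where the product formula `∏_v β_v(γ_v) = 1` holds and whose image lies in a subgroup
`Γ` on which `c_𝔸 ≡ 1`, the adelic lift IS the canonical element `(ι_𝔸 γ, 1)` (and likewise for a dual pair).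

This is the algebraic frame in which the global Weil representation of a dual pair is assembled from Kudla's
local splittings:
* S. Kudla, *Splitting metaplectic covers of dual reductive pairs*, Israel J. Math. 87 (1994) [Kudla1994]:
  local splittings `U(V)(F_v) → Mp(𝕎)(F_v)` with characters, trivial on the hyperspecial subgroup at almost
  all places;
* M. Harris, S. Kudla, W. Sweet, JAMS 9 (1996) [HarrisKudlaSweet1996] §1: the global metaplectic group
  `Mp(𝕎)(𝔸)` and the global splitting determined by a Hecke character `χ` as the product of the local ones;
* S. Kudla, *Notes on the local theta correspondence* (1996) [Kudla1996], Chap. I §4, Chap. II §4 (the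
  coordinate model `Sp(W) × ℂ^×` with cocycle multiplication; "`c_𝕐(h₁,h₂) = 1` … defines a homomorphism");
* A. Weil, Acta Math. 111 (1964) [Weil1964], n° 37–41: the adelic metaplectic group `Mp(X)_A` and the canonical
  lift `r_k` of the rational points — the target of the field `s_rat` of the tree's
  `Literature.NumberTheory.Weil1964.ThetaKernelDatum`.

WHAT IS CONSTRUCTED / PROVED (kernel, no cited fact): `finite_mulSupport_cocycle`, `piCocycle` (+ `_apply`,
`_mulSingle_mulSingle`), `single` (local embedding of twisted products, a homomorphism), `piHom` (the
restricted-product map of the `ι_v`), `piFun` / `finite_mulSupport_piFun` / `isSplitting_piFun` (product of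
local splitting functions splits the product cocycle), `piHom_mulSingle`, `lift_piFun_mulSingle` (local-global
compatibility of the lifts), `lift_piFun_mem_range_secHom` and `pairLift_piFun_mem_range_secHom` (rational
clause).  Every "almost all `v`" hypothesis is an explicit `∀ᶠ v in cofinite` argument; every product formula
is an explicit hypothesis — NOTHING about any specific cocycle or splitting is asserted.

NOT here: topology on the twisted product; the specific cocycles (Rao) and splittings (Kudla) — place-by-place
computations in the Schrödinger models; the product formulas themselves (Hilbert reciprocity, Weil's product
formula for the Weil index, automorphy of Hecke characters); the Weil representation.

STATUS OF THE RATIONAL CLAUSE: `secHom Γ hΓ` (tree `CocycleCentralExtension`) needs `hΓ : c|Γ×Γ = 1`, which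
holds for a Leray-normalised cocycle but NOT for Rao's normalised cocycle (cf. Kudla–Rapoport–Yang 2006,
§8.5: the two differ by the coboundary of Rao's normalising factor); the lemmas `lift_piFun_mem_range_secHom` / `pairLiftPi_mem_range_secHom` are
therefore plain API for that case.  The intended discharge of the rational clause for the theta kernel does
NOT go through a product formula for the cocycle: it uses the splitting over the rational points FORCED by
the invariance of the theta functional (tree `Literature.GroupTheory.InvariantFunctionalSplitting`,
`existsUnique_isSplitting_of_closure`), compared with the product splitting `piFun` by uniqueness
(`TwistedProduct.IsSplitting` lifts with the same operators fixing `Θ` are equal).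

## References

* [Kudla1994] S. Kudla, Israel J. Math. 87 (1994) 361–401, §3.
* [HarrisKudlaSweet1996] M. Harris, S. Kudla, W. Sweet, JAMS 9 (1996), §1.
* [Kudla1996] S. Kudla, Notes on the local theta correspondence, Chap. I §4, Chap. II §4.
* [Weil1964] A. Weil, Acta Math. 111 (1964), n° 37–41.
-/

namespace Literature.NumberTheory.Automorphic.RestrictedCocycle

open RestrictedProduct Filter Set Function
open _root_.Literature.GroupTheory

universe u v w

variable {ι : Type u}
variable {G : ι → Type v} [∀ i, Group (G i)]
variable {S : ι → Type w} [∀ i, SetLike (S i) (G i)] [∀ i, SubgroupClass (S i) (G i)] {K : ∀ i, S i}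
variable {A : Type*} [CommGroup A]

/-! ## 1. The adelic cocycle `c_𝔸(x, y) = ∏_v c_v(x_v, y_v)` -/

section Cocycle

variable (c : ∀ i, CentralCocycle (G i) A)
  (hc : ∀ᶠ i in cofinite, ∀ k ∈ K i, ∀ k' ∈ K i, c i k k' = 1)

omit [∀ i, SubgroupClass (S i) (G i)] in
include hc in
/-- for `x, y` in the restricted product, `c_v(x_v, y_v) = 1` for almost all `v` (both coordinates lie in
`K_v` and `c_v ≡ 1` on `K_v × K_v` for almost all `v`). [folklore] -/
theorem eventually_cocycle_apply_eq_one (x y : Πʳ i, [G i, K i]) :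
    ∀ᶠ i in cofinite, c i (x i) (y i) = 1 := by
  filter_upwards [hc, x.2, y.2] with i hci hxi hyi using hci _ hxi _ hyi

omit [∀ i, SubgroupClass (S i) (G i)] in
include hc in
/-- … hence `v ↦ c_v(x_v, y_v)` has finite multiplicative support: the adelic product is a finite product.
[folklore] -/
theorem finite_mulSupport_cocycle (x y : Πʳ i, [G i, K i]) :
    (mulSupport fun i => c i (x i) (y i)).Finite :=
  eventually_cofinite.mp (eventually_cocycle_apply_eq_one c hc x y)

/-- **The adelic cocycle** `c_𝔸(x, y) = ∏_v c_v(x_v, y_v)` on the restricted product `Πʳ v, [G_v, K_v]`: a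
normalized central 2-cocycle (the cocycle identity and the normalization hold factor by factor, and all
products are finite) — the multiplication of the global metaplectic-type group
`Mp(𝔸) = (Πʳ_v G_v) × A`, `(x, a)(y, b) = (xy, ab ∏_v c_v(x_v, y_v))` ([HarrisKudlaSweet1996, §1];
[Weil1964, n° 37–38]). [folklore] -/
noncomputable def piCocycle : CentralCocycle (Πʳ i, [G i, K i]) A where
  toFun x y := ∏ᶠ i, c i (x i) (y i)
  cocycle' x y z := by
    rw [← finprod_mul_distrib (finite_mulSupport_cocycle c hc x y) (finite_mulSupport_cocycle c hc (x * y) z),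
      ← finprod_mul_distrib (finite_mulSupport_cocycle c hc x (y * z)) (finite_mulSupport_cocycle c hc y z)]
    exact finprod_congr fun i => by simp only [RestrictedProduct.mul_apply, (c i).cocycle]
  map_one_one' := by simp

/-- `c_𝔸(x, y) = ∏ᶠ_v c_v(x_v, y_v)`. [folklore] -/
theorem piCocycle_apply (x y : Πʳ i, [G i, K i]) : piCocycle c hc x y = ∏ᶠ i, c i (x i) (y i) := rfl

/-- the adelic cocycle as a FINITE product over any finite set of places containing the support. [folklore] -/
theorem piCocycle_apply_eq_prod (x y : Πʳ i, [G i, K i]) (T : Finset ι)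
    (hT : (mulSupport fun i => c i (x i) (y i)) ⊆ T) :
    piCocycle c hc x y = ∏ i ∈ T, c i (x i) (y i) :=
  finprod_eq_prod_of_mulSupport_subset _ hT

variable [DecidableEq ι]

/-- on elements concentrated at one place the adelic cocycle is the local one:
`c_𝔸(g_{(v)}, g′_{(v)}) = c_v(g, g′)` (all other factors are `c_w(1,1) = 1`). [folklore] -/
theorem piCocycle_mulSingle_mulSingle (i : ι) (g g' : G i) :
    piCocycle c hc (mulSingle K i g) (mulSingle K i g') = c i g g' := by
  rw [piCocycle_apply, finprod_eq_single _ i]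
  · simp
  · intro j hj
    simp [hj]

/-- **The local embedding** `G_v ×_{c_v} A →* (Πʳ G) ×_{c_𝔸} A`, `(g, a) ↦ (g_{(v)}, a)` — a homomorphism
(`Mp(𝕎)(F_v) → Mp(𝕎)(𝔸)`). [folklore] -/
noncomputable def single (i : ι) : TwistedProduct (c i) →* TwistedProduct (piCocycle c hc) where
  toFun x := ⟨mulSingle K i x.g, x.a⟩
  map_one' := by
    ext
    · simp [TwistedProduct.one_def, mulSingle_one]
    · simp [TwistedProduct.one_def]
  map_mul' x y := by
    ext
    · simp [mulSingle_mul]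
    · simp [piCocycle_mulSingle_mulSingle]

/-- `single v (g, a) = (g_{(v)}, a)`: `G`-coordinate. [folklore] -/
@[simp] theorem single_apply_g (i : ι) (x : TwistedProduct (c i)) : (single c hc i x).g = mulSingle K i x.g := rfl

/-- `single v (g, a) = (g_{(v)}, a)`: `A`-coordinate. [folklore] -/
@[simp] theorem single_apply_a (i : ι) (x : TwistedProduct (c i)) : (single c hc i x).a = x.a := rfl

/-- the local embedding is injective. [folklore] -/
theorem single_injective (i : ι) : Function.Injective (single c hc i) := fun x y h => by
  have h₁ := congrArg TwistedProduct.g h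
  have h₂ := congrArg TwistedProduct.a h
  simp only [single_apply_g, mulSingle_inj, single_apply_a] at h₁ h₂
  exact TwistedProduct.ext h₁ h₂

/-- the local embedding on the centre: `single v (inl a) = inl a`. [folklore] -/
theorem single_inl (i : ι) (a : A) : single c hc i (TwistedProduct.inl (c i) a) = TwistedProduct.inl _ a := by
  ext <;> simp [mulSingle_one]

/-- the local embeddings at two distinct places commute (their `G`-parts have disjoint supports and the
cross cocycle factors are `c_w(g,1) = c_w(1,g′) = 1`). [folklore] -/
theorem commute_single_single {i j : ι} (hij : i ≠ j) (x : TwistedProduct (c i)) (y : TwistedProduct (c j)) :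
    Commute (single c hc i x) (single c hc j y) := by
  rw [TwistedProduct.commute_iff]
  constructor
  · -- `mulSingle i g` and `mulSingle j g′` commute coordinatewise
    show mulSingle K i x.g * mulSingle K j y.g = mulSingle K j y.g * mulSingle K i x.g
    ext k
    simp only [RestrictedProduct.mul_apply, coe_mulSingle_apply]
    by_cases hki : k = i
    · subst hki
      simp [hij]
    · by_cases hkj : k = j
      · subst hkj
        simp [hki]
      · simp [hki, hkj]
  · simp only [single_apply_g, piCocycle_apply, coe_mulSingle_apply]
    refine finprod_congr fun k => ?_
    by_cases hki : k = i
    · subst hki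
      simp [hij]
    · by_cases hkj : k = j
      · subst hkj
        simp [hki]
      · simp [hki, hkj]

end Cocycle

/-! ## 2. Adelic splittings `β_𝔸(h) = ∏_v β_v(h_v)` -/

section Splitting

variable (c : ∀ i, CentralCocycle (G i) A)
  (hc : ∀ᶠ i in cofinite, ∀ k ∈ K i, ∀ k' ∈ K i, c i k k' = 1)
variable {H : ι → Type*} [∀ i, Group (H i)]
variable {S' : ι → Type*} [∀ i, SetLike (S' i) (H i)] [∀ i, SubgroupClass (S' i) (H i)] {K' : ∀ i, S' i}
variable (ιv : ∀ i, H i →* G i) (hι : ∀ᶠ i in cofinite, MapsTo (ιv i) (K' i) (K i))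

/-- **The restricted-product homomorphism** `ι_𝔸 = ∏_v ι_v : Πʳ v, [H_v, K′_v] →* Πʳ v, [G_v, K_v]` of local
homomorphisms carrying `K′_v` into `K_v` for almost all `v` (Mathlib `mapAlongMonoidHom` over the identity
of the index set) — e.g. the adelic points of the embedding `U(V) × U(W) ↪ Sp(𝕎)` of a dual pair.
[folklore] -/
def piHom : (Πʳ i, [H i, K' i]) →* Πʳ i, [G i, K i] :=
  mapAlongMonoidHom H G id tendsto_id (fun i => ιv i) hι

/-- `(ι_𝔸 h)_v = ι_v(h_v)`. [folklore] -/
@[simp] theorem piHom_apply (h : Πʳ i, [H i, K' i]) (i : ι) : piHom ιv hι h i = ιv i (h i) := rfl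

/-- `ι_𝔸` on an element concentrated at one place. [folklore] -/
theorem piHom_mulSingle [DecidableEq ι] (i : ι) (x : H i) :
    piHom ιv hι (mulSingle K' i x) = mulSingle K i (ιv i x) := by
  ext j
  rw [piHom_apply, coe_mulSingle_apply, coe_mulSingle_apply]
  by_cases hji : j = i
  · subst hji
    simp
  · simp [hji]

variable (β : ∀ i, H i → A) (hβK : ∀ᶠ i in cofinite, ∀ k ∈ K' i, β i k = 1)

/-- the product function `β_𝔸(h) = ∏ᶠ_v β_v(h_v)` of local functions trivial on `K′_v` for almost all `v`
(the global splitting function of [HarrisKudlaSweet1996, §1] assembled from Kudla's local ones).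
[folklore] -/
noncomputable def piFun : (Πʳ i, [H i, K' i]) → A := fun h => ∏ᶠ i, β i (h i)

omit [∀ i, Group (H i)] [∀ i, SubgroupClass (S' i) (H i)] in
/-- `β_𝔸(h) = ∏ᶠ_v β_v(h_v)`. [folklore] -/
theorem piFun_apply (h : Πʳ i, [H i, K' i]) : piFun β h = ∏ᶠ i, β i (h i) := rfl

omit [∀ i, Group (H i)] [∀ i, SubgroupClass (S' i) (H i)] in
include hβK in
/-- `β_v(h_v) = 1` for almost all `v`. [folklore] -/
theorem eventually_apply_eq_one (h : Πʳ i, [H i, K' i]) : ∀ᶠ i in cofinite, β i (h i) = 1 := by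
  filter_upwards [hβK, h.2] with i hβi hhi using hβi _ hhi

omit [∀ i, Group (H i)] [∀ i, SubgroupClass (S' i) (H i)] in
include hβK in
/-- … hence `v ↦ β_v(h_v)` has finite multiplicative support. [folklore] -/
theorem finite_mulSupport_piFun (h : Πʳ i, [H i, K' i]) : (mulSupport fun i => β i (h i)).Finite :=
  eventually_cofinite.mp (eventually_apply_eq_one β hβK h)

omit [∀ i, Group (H i)] [∀ i, SubgroupClass (S' i) (H i)] in
/-- `β_𝔸` as a finite product over any finite set of places containing the support. [folklore] -/
theorem piFun_apply_eq_prod (h : Πʳ i, [H i, K' i]) (T : Finset ι) (hT : (mulSupport fun i => β i (h i)) ⊆ T) :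
    piFun β h = ∏ i ∈ T, β i (h i) :=
  finprod_eq_prod_of_mulSupport_subset _ hT

/-- `β_𝔸` on an element concentrated at one place is `β_v` (given that every `β_w` is normalized, as
splitting functions are). [folklore] -/
theorem piFun_mulSingle [DecidableEq ι] (hβ1 : ∀ j, β j 1 = 1) (i : ι) (x : H i) :
    piFun β (mulSingle K' i x) = β i x := by
  rw [piFun_apply, finprod_eq_single _ i]
  · simp
  · intro j hj
    rw [coe_mulSingle_apply, Pi.mulSingle_eq_of_ne hj, hβ1 j]

include hβK in
/-- **Local splittings assemble to an adelic splitting.** If every `β_v` splits `c_v` over `ι_v` (and `β_v ≡ 1`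
on `K′_v`, `c_v ≡ 1` on `K_v × K_v`, `ι_v(K′_v) ⊆ K_v` for almost all `v`), then `β_𝔸 = ∏_v β_v` splits the
adelic cocycle `c_𝔸` over `ι_𝔸` — i.e. `h ↦ (ι_𝔸 h, β_𝔸 h)` is a homomorphism `Πʳ H_v →* (Πʳ G_v) ×_{c_𝔸} A`
(the global splitting `U(V)(𝔸) → Mp(𝕎)(𝔸)` of [HarrisKudlaSweet1996, §1] from the local ones of
[Kudla1994]). [folklore] -/
theorem isSplitting_piFun (hβ : ∀ i, TwistedProduct.IsSplitting (c i) (ιv i) (β i)) :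
    TwistedProduct.IsSplitting (piCocycle c hc) (piHom ιv hι) (piFun β) := by
  intro h h'
  have fβ := finite_mulSupport_piFun β hβK
  have fc : (mulSupport fun i => c i (ιv i (h i)) (ιv i (h' i))).Finite :=
    finite_mulSupport_cocycle c hc (piHom ιv hι h) (piHom ιv hι h')
  have fββ : (mulSupport fun i => β i (h i) * β i (h' i)).Finite :=
    ((fβ h).union (fβ h')).subset (mulSupport_mul _ _)
  calc piFun β (h * h')
      = ∏ᶠ i, β i (h i) * β i (h' i) * c i (ιv i (h i)) (ιv i (h' i)) :=
        finprod_congr fun i => by rw [RestrictedProduct.mul_apply, hβ i]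
    _ = (∏ᶠ i, β i (h i) * β i (h' i)) * ∏ᶠ i, c i (ιv i (h i)) (ιv i (h' i)) := finprod_mul_distrib fββ fc
    _ = (∏ᶠ i, β i (h i)) * (∏ᶠ i, β i (h' i)) * ∏ᶠ i, c i (ιv i (h i)) (ιv i (h' i)) := by
        rw [finprod_mul_distrib (fβ h) (fβ h')]
    _ = piFun β h * piFun β h' * piCocycle c hc (piHom ιv hι h) (piHom ιv hι h') := rfl

/-- **Local-global compatibility of the lifts**: on an element concentrated at `v`, the adelic lift is the
local lift followed by the local embedding, `ι̃_𝔸(h_{(v)}) = single_v(ι̃_v(h))`. [folklore] -/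
theorem lift_piFun_mulSingle [DecidableEq ι] (hβ : ∀ i, TwistedProduct.IsSplitting (c i) (ιv i) (β i)) (i : ι)
    (x : H i) :
    (isSplitting_piFun c hc ιv hι β hβK hβ).lift (mulSingle K' i x) = single c hc i ((hβ i).lift x) := by
  ext
  · rw [TwistedProduct.IsSplitting.lift_apply_g, single_apply_g, TwistedProduct.IsSplitting.lift_apply_g,
      piHom_mulSingle]
  · rw [TwistedProduct.IsSplitting.lift_apply_a, single_apply_a, TwistedProduct.IsSplitting.lift_apply_a,
      piFun_mulSingle β (fun j => (hβ j).map_one)]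

/-! ## 3. The rational-points clause -/

/-- **Rational-points clause (one group).** Let `Γ` be a subgroup of `Πʳ G_v` on which the adelic cocycle is
identically `1` (PRODUCT FORMULA for the cocycle on rational points) and let `γ ∈ Πʳ H_v` with `ι_𝔸 γ ∈ Γ` satisfy
the PRODUCT FORMULA `∏_v β_v(γ_v) = 1`.  Then the adelic lift of `γ` is the canonical element `(ι_𝔸 γ, 1)`,
i.e. lies in the range of `secHom Γ` — the field `s_rat` of the tree's `Weil1964.ThetaKernelDatum` for one
member of the pair.  Both product formulas are HYPOTHESES here. [folklore] -/
theorem lift_piFun_mem_range_secHom (hβ : ∀ i, TwistedProduct.IsSplitting (c i) (ιv i) (β i))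
    (Γ : Subgroup (Πʳ i, [G i, K i])) (hΓ : ∀ γ ∈ Γ, ∀ γ' ∈ Γ, piCocycle c hc γ γ' = 1)
    (γ : Πʳ i, [H i, K' i]) (hγ : piHom ιv hι γ ∈ Γ) (hprod : ∏ᶠ i, β i (γ i) = 1) :
    (isSplitting_piFun c hc ιv hι β hβK hβ).lift γ ∈ (TwistedProduct.secHom Γ hΓ).range :=
  (isSplitting_piFun c hc ιv hι β hβK hβ).lift_mem_range_secHom Γ hΓ γ hγ hprod

variable {H₂ : ι → Type*} [∀ i, Group (H₂ i)]
variable {S₂ : ι → Type*} [∀ i, SetLike (S₂ i) (H₂ i)] [∀ i, SubgroupClass (S₂ i) (H₂ i)] {K₂ : ∀ i, S₂ i}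
variable (ιv₂ : ∀ i, H₂ i →* G i) (hι₂ : ∀ᶠ i in cofinite, MapsTo (ιv₂ i) (K₂ i) (K i))
variable (β₂ : ∀ i, H₂ i → A) (hβK₂ : ∀ᶠ i in cofinite, ∀ k ∈ K₂ i, β₂ i k = 1)

/-- commuting local images give commuting adelic images. [folklore] -/
theorem commute_piHom (hcomm : ∀ i (h₁ : H i) (h₂ : H₂ i), Commute (ιv i h₁) (ιv₂ i h₂))
    (h₁ : Πʳ i, [H i, K' i]) (h₂ : Πʳ i, [H₂ i, K₂ i]) :
    Commute (piHom ιv hι h₁) (piHom ιv₂ hι₂ h₂) := by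
  rw [Commute, SemiconjBy]
  ext i
  simpa only [RestrictedProduct.mul_apply, piHom_apply] using (hcomm i (h₁ i) (h₂ i)).eq

/-- place-by-place symmetry of the cocycles on the two images gives symmetry of the adelic cocycle.
[folklore] -/
theorem piCocycle_symm (hsym : ∀ i (h₁ : H i) (h₂ : H₂ i), c i (ιv i h₁) (ιv₂ i h₂) = c i (ιv₂ i h₂) (ιv i h₁))
    (h₁ : Πʳ i, [H i, K' i]) (h₂ : Πʳ i, [H₂ i, K₂ i]) :
    piCocycle c hc (piHom ιv hι h₁) (piHom ιv₂ hι₂ h₂) = piCocycle c hc (piHom ιv₂ hι₂ h₂) (piHom ιv hι h₁) := by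
  simp only [piCocycle_apply, piHom_apply]
  exact finprod_congr fun i => hsym i _ _

/-- **The adelic dual-pair homomorphism** `Πʳ H_v × Πʳ H₂,v →* (Πʳ G_v) ×_{c_𝔸} A` assembled from two families
of local splittings with commuting images on which the local cocycles are symmetric (the map
`U(V)(𝔸) × U(W)(𝔸) → Mp(𝕎)(𝔸)`; the field `s` of the tree's `Weil1964.ThetaKernelDatum`). [folklore] -/
noncomputable def pairLiftPi (hβ : ∀ i, TwistedProduct.IsSplitting (c i) (ιv i) (β i))
    (hβ₂ : ∀ i, TwistedProduct.IsSplitting (c i) (ιv₂ i) (β₂ i))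
    (hcomm : ∀ i (h₁ : H i) (h₂ : H₂ i), Commute (ιv i h₁) (ιv₂ i h₂))
    (hsym : ∀ i (h₁ : H i) (h₂ : H₂ i), c i (ιv i h₁) (ιv₂ i h₂) = c i (ιv₂ i h₂) (ιv i h₁)) :
    (Πʳ i, [H i, K' i]) × (Πʳ i, [H₂ i, K₂ i]) →* TwistedProduct (piCocycle c hc) :=
  TwistedProduct.pairLift (isSplitting_piFun c hc ιv hι β hβK hβ) (isSplitting_piFun c hc ιv₂ hι₂ β₂ hβK₂ hβ₂)
    (commute_piHom ιv hι ιv₂ hι₂ hcomm) (piCocycle_symm c hc ιv hι ιv₂ hι₂ hsym)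

/-- the adelic dual-pair homomorphism in coordinates:
`(h₁, h₂) ↦ (ι_𝔸h₁ · ι₂,𝔸h₂, β_𝔸(h₁) β₂,𝔸(h₂) c_𝔸(ι_𝔸h₁, ι₂,𝔸h₂))`. [folklore] -/
theorem pairLiftPi_apply (hβ : ∀ i, TwistedProduct.IsSplitting (c i) (ιv i) (β i))
    (hβ₂ : ∀ i, TwistedProduct.IsSplitting (c i) (ιv₂ i) (β₂ i))
    (hcomm : ∀ i (h₁ : H i) (h₂ : H₂ i), Commute (ιv i h₁) (ιv₂ i h₂))
    (hsym : ∀ i (h₁ : H i) (h₂ : H₂ i), c i (ιv i h₁) (ιv₂ i h₂) = c i (ιv₂ i h₂) (ιv i h₁))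
    (p : (Πʳ i, [H i, K' i]) × (Πʳ i, [H₂ i, K₂ i])) :
    pairLiftPi c hc ιv hι β hβK ιv₂ hι₂ β₂ hβK₂ hβ hβ₂ hcomm hsym p =
      ⟨piHom ιv hι p.1 * piHom ιv₂ hι₂ p.2,
        piFun β p.1 * piFun β₂ p.2 * piCocycle c hc (piHom ιv hι p.1) (piHom ιv₂ hι₂ p.2)⟩ :=
  TwistedProduct.pairLift_apply _ _ _ _ p

/-- **Rational-points clause (dual pair).** If `ι_𝔸 γ₁, ι₂,𝔸 γ₂` lie in a subgroup `Γ` on which `c_𝔸 ≡ 1` and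
both product formulas `∏_v β_v(γ₁,v) = 1`, `∏_v β₂,v(γ₂,v) = 1` hold, then the adelic dual-pair homomorphism
carries `(γ₁, γ₂)` into the range of the canonical homomorphism `secHom Γ` — literally the field `s_rat` of
the tree's `Weil1964.ThetaKernelDatum` ("`s` carries `ΓU × Γ` into the rational lift `r_k(Ps(X)_k)`") with
`rat := (secHom Γ).range`.  All three product formulas are HYPOTHESES here. [folklore] -/
theorem pairLiftPi_mem_range_secHom (hβ : ∀ i, TwistedProduct.IsSplitting (c i) (ιv i) (β i))
    (hβ₂ : ∀ i, TwistedProduct.IsSplitting (c i) (ιv₂ i) (β₂ i))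
    (hcomm : ∀ i (h₁ : H i) (h₂ : H₂ i), Commute (ιv i h₁) (ιv₂ i h₂))
    (hsym : ∀ i (h₁ : H i) (h₂ : H₂ i), c i (ιv i h₁) (ιv₂ i h₂) = c i (ιv₂ i h₂) (ιv i h₁))
    (Γ : Subgroup (Πʳ i, [G i, K i])) (hΓ : ∀ γ ∈ Γ, ∀ γ' ∈ Γ, piCocycle c hc γ γ' = 1)
    (γ₁ : Πʳ i, [H i, K' i]) (γ₂ : Πʳ i, [H₂ i, K₂ i])
    (hγ₁ : piHom ιv hι γ₁ ∈ Γ) (hγ₂ : piHom ιv₂ hι₂ γ₂ ∈ Γ)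
    (hprod₁ : ∏ᶠ i, β i (γ₁ i) = 1) (hprod₂ : ∏ᶠ i, β₂ i (γ₂ i) = 1) :
    pairLiftPi c hc ιv hι β hβK ιv₂ hι₂ β₂ hβK₂ hβ hβ₂ hcomm hsym (γ₁, γ₂) ∈
      (TwistedProduct.secHom Γ hΓ).range :=
  TwistedProduct.pairLift_mem_range_secHom Γ hΓ (isSplitting_piFun c hc ιv hι β hβK hβ)
    (isSplitting_piFun c hc ιv₂ hι₂ β₂ hβK₂ hβ₂) _ _ γ₁ γ₂ hγ₁ hγ₂ hprod₁ hprod₂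

/-- the local criterion for the cocycle product formula: if the local values `c_v(γ_v, γ′_v)` at two points
multiply to `1` (e.g. each is a Hilbert symbol / Weil index of a GLOBAL quantity), then `c_𝔸(γ, γ′) = 1` —
a restatement making the hypothesis `hΓ` above checkable place by place. [folklore] -/
theorem piCocycle_eq_one_iff (γ γ' : Πʳ i, [G i, K i]) :
    piCocycle c hc γ γ' = 1 ↔ ∏ᶠ i, c i (γ i) (γ' i) = 1 := Iff.rfl

end Splitting

end Literature.NumberTheory.Automorphic.RestrictedCocycle
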